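import Literature.MathematicalPhysics.QuantumFieldTheory.Balaban1983to89.B9Eq357Levels

/-!
# `Balaban1983to89.B9Eq332AvgCovariance` — B9 p. 395, (3.32): the GAUGE COVARIANCE of the transported block averages
# `Q′_j(U)` of (3.19), PROVED for the concrete averages of the tree on `ℤ^d` (one-step `Q′(V)`, the composite `Q′_j(U)` and
# its collapsed form), for every invertible gauge function and every background — no smallness

HONEST FRAMING (cell `lit-balaban`, verbatim): statement-level skeleton of published theorems with citation tags; proofs
where landed; nothing here is a claim about the Yang–Mills mass gap.

CITATION HEADER (lean-in-tree rule).  T. Bałaban, *Propagators for lattice gauge theories in a background field*, Commun.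
Math. Phys. **99** (1985) 389–434 [`Balaban1985BackgroundPropagators`] (cell paper B9; journal page = PDF page + 388),
pp. 395–396 [PDF 7–8] (3.28), (3.32); p. 393 [PDF 5] (3.19); the averages, contours and the gauge covariance (11) of the
averaging operation are those of [5] = T. Bałaban, *Averaging operations for lattice gauge theories*, Commun. Math. Phys. **98**
(1985) 17–51 [`Balaban1985Averaging`], (8) p. 18, (11) p. 19, (42)–(43), (45) p. 24, (52)–(53) p. 26.  Cell `lit-balaban` seat
r06 gen 5 (B9 fold owner), SKELETON row `B9.Eq3.28` (= (3.28)–(3.34); the (3.32) member); text read from the held text layer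
`paper:balaban1985-cmp99-background-propagators` p. 7 and the render `b2b-balaban-ref1/pages/…-p007-x2.png`.

WHAT IS PRINTED (p. 395, verbatim).  *"All the operators introduced above depend on a gauge field configuration U. Let us
discuss how these operators transform under gauge transformations of the configuration U. … U → U^u, U′ → R(u)U′, (3.28) where
U^u(x,x′) = u(x)U(x,x′)u⁻¹(x′), (R(u)U′)(x,x′) = R(u(x))U′(x,x′), … The matrices in the definitions (3.19) transform as
follows R(U^u(Γ^{(j)}_{y,x})) = R(u(y))R(U(Γ^{(j)}_{y,x}))R(u⁻¹(x)), hence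
  (Q′_j(U^u)R(u)λ)(y) = R(u(y))(Q′_j(U)λ)(y),                                                            (3.32)
and Q′\*(U^u)aQ′(U^u) = R(u)Q′\*(U)aQ′(U)R(u⁻¹)."*  With (3.19) p. 393: *"(Q′(V)λ)(y) = Σ_{x∈B(y)} L^{−d}R(V(Γ_{y,x}))λ(x),
(Q′_j(U)λ)(y) = (Q′(Ū^{j−1})·…·Q′(Ū)Q′(U)λ)(y) = Σ_{x∈B^j(y)} L^{−jd}R(U(Γ^{(j)}_{y,x}))λ(x), y ∈ T^{(j)}_1,"* and `R(X)Y = XYX⁻¹`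
(p. 390).  In the tree (3.32) was so far only the HYPOTHESIS shape `h32a`/`h32b` of the abstract intertwining model
`B9Eq333Cov` ((3.33)/(3.34) proved FROM it; its header: *"NOT HERE: the definitions (3.12)/(3.19) … and the verification of
(3.29)–(3.32) from them"*); (3.29)–(3.31) were verified concretely in `B9Eq3117Current` (r06 gen 1).

CARRIERS (REUSED BY NAME, nothing restated; every level read on `ℤ^d`, lineage conventions of the cell's [5]-files): sites
`B7Prop1Explicit.Site d = ℤ^d`, gauge transformation `gaugeAct u V` ((8) of [5] = `U^u` of (3.28)), parallel transport `hol`,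
tree contours `treeWord` (Γ_{y,x}), block offsets `boxVec`; the tower of averages `Ū^l = avgIter L U l` ((43) of [5],
`B7Prop2Explicit`) with its gauge covariance **for every invertible `u`** `\overline{(U^u)}^l = (Ū^l)^{u_l}`, `u_l(z) = u(Lˡz)`
(`B7Prop6Flat.avgIter_gaugeAct_units`, `B7AvgGaugeCovariance.uLev`); the composite contours (52)–(53) through the tower gauge
function `B8Eq115GaugeFixing.tg`; the one-step average `Q′(V)` = `B9Eq3113Proof.Qp`, the composite (3.19) first form
`Q′_j(U)` = `B9Eq3113Proof.QpIter`, the collapsed form = `B9Eq358Decomposition.QpC` with `U(Γ^{(j)}_{y,x})` = `compT` and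
`Q′_j|λ|` = `QpAbs` (p06; `B9Eq357Levels.QpC_eq_QpIter` identifies the two forms); `R` = `B7Eq78Linearization.conjR`.

WHAT THIS FILE PROVES (theorems only; 0 definitions, 0 `Prop` placeholders; axioms standard).
* §1 `tg_cov` — gauge covariance of the tower gauge function along the composite contours: if every level of a tower
  transforms as `W′_l = (W_l)^{u_l}`, then `u′_{(n)}(x) = u_k(y)·u_{(n)}(x)·u_{k−n}(x)⁻¹` (depth `n ≦ k`) — the telescoping of
  [5] (8) along (52)–(53) (pure group algebra, any group).
* §2 **`compT_gaugeAct`** — the printed *"R(U^u(Γ^{(j)}_{y,x})) = R(u(y))R(U(Γ^{(j)}_{y,x}))R(u⁻¹(x))"* at the level of the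
  transporters: `(U^u)(Γ^{(j)}_{y,x}) = u(Lʲy)·U(Γ^{(j)}_{y,x})·u(x)⁻¹` for EVERY background `U` and EVERY invertible `u` (the
  level-`j` site `y` is the fine site `Lʲy` in the `ℤ^d` reading), and `conjR_compT_gaugeAct` (the `R`-form, applied to a vector).
* §3 **(3.32)**: `Qp_gaugeAct` (one step: `(Q′(V^u)R(u)λ)(y) = R(u(y))(Q′(V)λ)(y)`), **`QpIter_gaugeAct`** (the composite
  `Q′_j(U)` of (3.19), first form: `(Q′_j(U^u)R(u)λ)(y) = R(u_j(y))(Q′_j(U)λ)(y)`), **`QpC_gaugeAct`** (the collapsed form) — all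
  unconditional.
* §4 for `u` with `|u|, |u⁻¹| ≦ 1` (`U1`, containing every unitary group; there `R(u)` is an isometry, `B8Ineq132.norm_conjR`):
  `norm_QpC_gaugeAct` / `norm_QpIter_gaugeAct` (`|(Q′_j(U^u)R(u)λ)(y)| = |(Q′_j(U)λ)(y)|` — the summands of the form (3.24)
  `⟨λ,Q′*aQ′λ⟩ = Σ_j a_j Σ_{y∈Λ_j}(Lʲη)^{d−2}|(Q′_j(U)λ)(y)|²` are gauge invariant, i.e. the second clause of (3.32),
  `Q′*(U^u)aQ′(U^u) = R(u)Q′*(U)aQ′(U)R(u⁻¹)`, at the level of the defining quadratic form: `form324_gaugeAct` for any finite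
  family of levels/sites/weights), and `QpAbs_conjR` (`Q′_j|R(u)λ| = Q′_j|λ|`, the right-hand side of (3.59)).

NOT CLAIMED: the operator (polarized) form of the second clause of (3.32) and (3.33)–(3.34) — they are `B9Eq333Cov`'s
`intertwine_of_quadForm` / `adj_intertwine` / `g_intertwine` … over abstract real inner-product carriers, whose hypothesis `h32a`
this file proves in the concrete `ℤ^d` model but does not re-bridge; the gauge-FIELD averages `Q_j(U)` of (3.13)–(3.15) (*"the
equalities (3.32) hold again"*, p. 396); norms: the tree's `‖·‖` on the abstract complete normed algebra `𝔸` stands for the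
print's `|·|` (cell note D-B9-1), its `U1`-invariance replacing unitary invariance.
-/

noncomputable section

open scoped BigOperators

namespace Literature.MathematicalPhysics.QuantumFieldTheory.Balaban1983to89.B9Eq332AvgCovariance

open B7Prop1Explicit B7Prop2Explicit B8Eq115GaugeFixing
open B8Ineq130 (fl)
open B7AvgGaugeCovariance (uLev uLev_apply uLev_smul uLev_zero)
open B7Prop6Flat (avgIter_gaugeAct_units)
open B7Eq78Linearization (conjR conjR_apply conjR_smul_real)
open B8Ineq132 (conjR_sum conjR_conjR one_conjR norm_conjR)
open B9Eq3113Proof (Qp Qp_eq_sum QpIter QpIter_zero QpIter_succ)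
open B9Eq358Decomposition (compT bsite QpC QpAbs)

variable {d : ℕ}

/-! ## §1 Gauge covariance of the tower gauge function along the composite contours (52)–(53) of [5] -/

section Tower

variable {G : Type*} [Group G]

/-- **Covariance of the tower gauge function** (the telescoping of [5] (8) `V^u(Γ_{z,x}) = u(z)V(Γ_{z,x})u(x)⁻¹` along the
composite contour (52)–(53)): if every level of the tower transforms as `W′_l = (W_l)^{u_l}`, `u_l(z) = u(Lˡz)`, `l ≦ k`, then at
every depth `n ≦ k` and every site `x` of the level `k − n`,
`tg L W′ k y n x = u_k(y) · tg L W k y n x · u_{k−n}(x)⁻¹`.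
[cite: Balaban1985BackgroundPropagators, (3.32) p.395; Balaban1985Averaging, (8) p.18, (52)–(53) p.26] -/
theorem tg_cov (L : ℕ) (u : B7Prop1Explicit.Site d → G) (W W' : ℕ → B7Prop1Explicit.Site d → Fin d → G) (k : ℕ)
    (y : B7Prop1Explicit.Site d) (hcov : ∀ l ≤ k, W' l = gaugeAct (uLev L u l) (W l)) :
    ∀ n ≤ k, ∀ x : B7Prop1Explicit.Site d,
      tg L W' k y n x = uLev L u k y * tg L W k y n x * (uLev L u (k - n) x)⁻¹
  | 0, _, x => by
      rw [tg_zero, tg_zero, hcov k le_rfl, axialFn_gaugeAct, Nat.sub_zero]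
  | n + 1, hn, x => by
      have hk : k - (n + 1) + 1 = k - n := by omega
      rw [tg_succ, tg_succ, tg_cov L u W W' k y hcov n (Nat.le_of_succ_le hn) (fl L x), hcov (k - (n + 1)) (by omega),
        axialFn_gaugeAct, uLev_smul, hk]
      group

end Tower

/-! ## §2 `U^u(Γ^{(j)}_{y,x}) = u(y)U(Γ^{(j)}_{y,x})u(x)⁻¹` for the composite transporters of (3.19)/(3.55) -/

section Transporters

variable {𝔸 : Type*} [NormedRing 𝔸] [NormedAlgebra ℂ 𝔸] [CompleteSpace 𝔸]

/-- **p. 395, the sentence before (3.32)**: *"The matrices in the definitions (3.19) transform as follows R(U^u(Γ^{(j)}_{y,x})) =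
R(u(y))R(U(Γ^{(j)}_{y,x}))R(u⁻¹(x))"* — at the level of the transporters along the composite contours (52)–(53) of [5] built on
the tower `Ū^l` (`compT`): `(U^u)(Γ^{(j)}_{y,x}) = u(Lʲy)·U(Γ^{(j)}_{y,x})·u(x)⁻¹`, for EVERY background `U : ℤ^d → 𝔸ˣ` and EVERY
invertible gauge function `u` (no smallness: the covariance (11) of the averages holds for the formal objects,
`B7Prop6Flat.avgIter_gaugeAct_units`).  The level-`j` site `y` is the fine site `Lʲy`.
[cite: Balaban1985BackgroundPropagators, (3.32) p.395, (3.19) p.393; Balaban1985Averaging, (11) p.19, (43) p.24] -/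
theorem compT_gaugeAct (L : ℕ) (u : B7Prop1Explicit.Site d → 𝔸ˣ) (U : B7Prop1Explicit.Site d → Fin d → 𝔸ˣ) (j : ℕ)
    (y x : B7Prop1Explicit.Site d) :
    compT L (gaugeAct u U) j y x = u (((L : ℤ) ^ j) • y) * compT L U j y x * (u x)⁻¹ := by
  have h := tg_cov L u (fun l => avgIter L U l) (fun l => avgIter L (gaugeAct u U) l) j y
    (fun l _ => avgIter_gaugeAct_units L u U l) j le_rfl x
  simpa only [compT, uLev_apply, Nat.sub_self, pow_zero, one_smul] using h

/-- The printed `R`-form: `R(U^u(Γ^{(j)}_{y,x})) = R(u(y))R(U(Γ^{(j)}_{y,x}))R(u⁻¹(x))` (as operators, applied to `X ∈ 𝔸`).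
[cite: Balaban1985BackgroundPropagators, (3.32) p.395] -/
theorem conjR_compT_gaugeAct (L : ℕ) (u : B7Prop1Explicit.Site d → 𝔸ˣ) (U : B7Prop1Explicit.Site d → Fin d → 𝔸ˣ)
    (j : ℕ) (y x : B7Prop1Explicit.Site d) (X : 𝔸) :
    conjR (compT L (gaugeAct u U) j y x) X = conjR (u (((L : ℤ) ^ j) • y)) (conjR (compT L U j y x) (conjR (u x)⁻¹ X)) := by
  rw [compT_gaugeAct, conjR_conjR, conjR_conjR]

end Transporters

/-! ## §3 (3.32): `(Q′_j(U^u)R(u)λ)(y) = R(u(y))(Q′_j(U)λ)(y)` -/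

section Eq332

variable {𝔸 : Type*} [NormedRing 𝔸] [NormedAlgebra ℂ 𝔸] [CompleteSpace 𝔸]

omit [NormedAlgebra ℂ 𝔸] [CompleteSpace 𝔸] in
/-- `R(u⁻¹)R(u) = 1` on vectors. [cite: Balaban1985BackgroundPropagators, (3.28) p.395] -/
theorem conjR_inv_conjR (v : 𝔸ˣ) (X : 𝔸) : conjR v⁻¹ (conjR v X) = X := by
  rw [conjR_conjR, inv_mul_cancel, one_conjR]

omit [CompleteSpace 𝔸] in
/-- **(3.32), ONE STEP**: `(Q′(V^u)R(u)λ)(y) = R(u(y))(Q′(V)λ)(y)` for the one-step transported average (3.19)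
`(Q′(V)λ)(y) = Σ_{x∈B(y)}L^{−d}R(V(Γ_{y,x}))λ(x)` (`B9Eq3113Proof.Qp`), every `V`, every invertible `u`: [5] (8) along the tree
contour, `V^u(Γ_{y,x}) = u(y)V(Γ_{y,x})u(x)⁻¹`. [cite: Balaban1985BackgroundPropagators, (3.32) p.395, (3.19) p.393; Balaban1985Averaging, (8) p.18] -/
theorem Qp_gaugeAct (L : ℕ) (u : B7Prop1Explicit.Site d → 𝔸ˣ) (V : B7Prop1Explicit.Site d → Fin d → 𝔸ˣ)
    (lam : B7Prop1Explicit.Site d → 𝔸) (y : B7Prop1Explicit.Site d) :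
    Qp L (gaugeAct u V) (fun x => conjR (u x) (lam x)) y = conjR (u y) (Qp L V lam y) := by
  rw [Qp_eq_sum, Qp_eq_sum, conjR_sum]
  refine Finset.sum_congr rfl fun r _ => ?_
  rw [conjR_smul_real, hol_gaugeAct, disp_treeWord, ← conjR_conjR, ← conjR_conjR, conjR_inv_conjR]

/-- **(3.32), THE COMPOSITE `Q′_j(U)` OF (3.19), first form** (`Q′(Ū^{j−1})⋯Q′(Ū)Q′(U)`, `B9Eq3113Proof.QpIter`):
`(Q′_j(U^u)R(u)λ)(y) = R(u_j(y))(Q′_j(U)λ)(y)`, `u_j(y) = u(Lʲy)`, every `U`, every invertible `u` — one step at each level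
with the covariance `\overline{(U^u)}^l = (Ū^l)^{u_l}` of the averages ([5] (11), `B7Prop6Flat.avgIter_gaugeAct_units`).
[cite: Balaban1985BackgroundPropagators, (3.32) p.395, (3.19) p.393; Balaban1985Averaging, (11) p.19] -/
theorem QpIter_gaugeAct (L : ℕ) (u : B7Prop1Explicit.Site d → 𝔸ˣ) (U : B7Prop1Explicit.Site d → Fin d → 𝔸ˣ)
    (lam : B7Prop1Explicit.Site d → 𝔸) :
    ∀ (j : ℕ) (y : B7Prop1Explicit.Site d),
      QpIter L (gaugeAct u U) (fun x => conjR (u x) (lam x)) j y = conjR (uLev L u j y) (QpIter L U lam j y)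
  | 0, y => by rw [QpIter_zero, QpIter_zero, uLev_zero]
  | j + 1, y => by
      have ih : QpIter L (gaugeAct u U) (fun x => conjR (u x) (lam x)) j
          = fun x => conjR (uLev L u j x) (QpIter L U lam j x) := funext (QpIter_gaugeAct L u U lam j)
      rw [QpIter_succ, QpIter_succ, avgIter_gaugeAct_units L u U j, ih, Qp_gaugeAct, uLev_smul]

/-- **(3.32), THE COLLAPSED FORM** `(Q′_j(U)λ)(y) = Σ_{x∈B^j(y)}L^{−jd}R(U(Γ^{(j)}_{y,x}))λ(x)` (`B9Eq358Decomposition.QpC`):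
`(Q′_j(U^u)R(u)λ)(y) = R(u(Lʲy))(Q′_j(U)λ)(y)` — *"hence"* from `R(U^u(Γ^{(j)}_{y,x})) = R(u(y))R(U(Γ^{(j)}_{y,x}))R(u⁻¹(x))`
(`compT_gaugeAct`), every `U`, every invertible `u`. [cite: Balaban1985BackgroundPropagators, (3.32) p.395, (3.19) p.393] -/
theorem QpC_gaugeAct (L : ℕ) (u : B7Prop1Explicit.Site d → 𝔸ˣ) (U : B7Prop1Explicit.Site d → Fin d → 𝔸ˣ) (j : ℕ)
    (lam : B7Prop1Explicit.Site d → 𝔸) (y : B7Prop1Explicit.Site d) :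
    QpC L (gaugeAct u U) j (fun x => conjR (u x) (lam x)) y = conjR (u (((L : ℤ) ^ j) • y)) (QpC L U j lam y) := by
  rw [QpC, QpC, conjR_sum]
  refine Finset.sum_congr rfl fun r _ => ?_
  rw [conjR_smul_real, conjR_compT_gaugeAct, conjR_inv_conjR]

end Eq332

/-! ## §4 `|(Q′_j(U^u)R(u)λ)(y)| = |(Q′_j(U)λ)(y)|` — the second clause of (3.32) at the level of the form (3.24) -/

section Norms

variable {𝔸 : Type*} [NormedRing 𝔸] [NormOneClass 𝔸] [NormedAlgebra ℂ 𝔸] [CompleteSpace 𝔸]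

/-- For `u` with `|u(Lʲy)|, |u(Lʲy)⁻¹| ≦ 1` (`U1`; every unitary-valued `u`), `R(u(Lʲy))` is an isometry, hence
`|(Q′_j(U^u)R(u)λ)(y)| = |(Q′_j(U)λ)(y)|` (collapsed form). [cite: Balaban1985BackgroundPropagators, (3.32) p.395, (3.24) p.394] -/
theorem norm_QpC_gaugeAct (L : ℕ) {u : B7Prop1Explicit.Site d → 𝔸ˣ} (hu : ∀ x, u x ∈ U1 𝔸)
    (U : B7Prop1Explicit.Site d → Fin d → 𝔸ˣ) (j : ℕ) (lam : B7Prop1Explicit.Site d → 𝔸) (y : B7Prop1Explicit.Site d) :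
    ‖QpC L (gaugeAct u U) j (fun x => conjR (u x) (lam x)) y‖ = ‖QpC L U j lam y‖ := by
  rw [QpC_gaugeAct, norm_conjR (hu _)]

/-- The same for the first form `Q′_j(U)` of (3.19). [cite: Balaban1985BackgroundPropagators, (3.32) p.395, (3.24) p.394] -/
theorem norm_QpIter_gaugeAct (L : ℕ) {u : B7Prop1Explicit.Site d → 𝔸ˣ} (hu : ∀ x, u x ∈ U1 𝔸)
    (U : B7Prop1Explicit.Site d → Fin d → 𝔸ˣ) (lam : B7Prop1Explicit.Site d → 𝔸) (j : ℕ) (y : B7Prop1Explicit.Site d) :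
    ‖QpIter L (gaugeAct u U) (fun x => conjR (u x) (lam x)) j y‖ = ‖QpIter L U lam j y‖ := by
  rw [QpIter_gaugeAct, norm_conjR (B7AvgGaugeCovariance.uLev_mem hu L j y)]

/-- **(3.32), second clause, as the gauge invariance of the defining form (3.24)**: `⟨λ,Q′*aQ′λ⟩ = Σ_j a_j Σ_{y∈Λ_j}
(Lʲη)^{d−2}|(Q′_j(U)λ)(y)|²` takes the same value at `(U^u, R(u)λ)` as at `(U, λ)` — for every finite family `s` of (level,
site, weight) triples (the `a_j(Lʲη)^{d−2}`, `y ∈ Λ_j`, `j ≦ k` of (3.24)); print: *"and Q′*(U^u)aQ′(U^u) = R(u)Q′*(U)aQ′(U)R(u⁻¹)"*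
(`Q′*aQ′` *"is defined by the same quadratic form"*, p. 394). [cite: Balaban1985BackgroundPropagators, (3.32) p.395, (3.24) p.394] -/
theorem form324_gaugeAct (L : ℕ) {u : B7Prop1Explicit.Site d → 𝔸ˣ} (hu : ∀ x, u x ∈ U1 𝔸)
    (U : B7Prop1Explicit.Site d → Fin d → 𝔸ˣ) (lam : B7Prop1Explicit.Site d → 𝔸) {ι : Type*} (s : Finset ι)
    (lev : ι → ℕ) (site : ι → B7Prop1Explicit.Site d) (w : ι → ℝ) :
    ∑ i ∈ s, w i * ‖QpC L (gaugeAct u U) (lev i) (fun x => conjR (u x) (lam x)) (site i)‖ ^ 2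
      = ∑ i ∈ s, w i * ‖QpC L U (lev i) lam (site i)‖ ^ 2 := by
  simp only [norm_QpC_gaugeAct L hu]

omit [NormedAlgebra ℂ 𝔸] [CompleteSpace 𝔸] in
/-- `(Q′_j|R(u)λ|)(y) = (Q′_j|λ|)(y)` — the right-hand side of (3.59) is gauge invariant for `u ∈ U1`.
[cite: Balaban1985BackgroundPropagators, (3.59) p.402, (3.32) p.395] -/
theorem QpAbs_conjR (L : ℕ) {u : B7Prop1Explicit.Site d → 𝔸ˣ} (hu : ∀ x, u x ∈ U1 𝔸) (j : ℕ)
    (lam : B7Prop1Explicit.Site d → 𝔸) (y : B7Prop1Explicit.Site d) :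
    QpAbs L j (fun x => conjR (u x) (lam x)) y = QpAbs L j lam y := by
  simp only [QpAbs, norm_conjR (hu _)]

end Norms

end Literature.MathematicalPhysics.QuantumFieldTheory.Balaban1983to89.B9Eq332AvgCovariance
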